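import Mathlib.Analysis.Calculus.LineDeriv.IntegrationByParts
import Mathlib.Analysis.Calculus.BumpFunction.InnerProduct
import Mathlib.Analysis.Calculus.FDeriv.Equiv
import Mathlib.Analysis.InnerProductSpace.Calculus
import Literature.Analysis.FunctionSpaces.LittlewoodPaley
import Literature.Analysis.FluidPDE.VectorCalculus
import Literature.Analysis.FunctionSpaces.SobolevDomainProofs
import HarnessLib

/-!
# Integration by parts on the whole space for compactly supported fields; smooth cut-offs

Analysis/FluidPDE support file (serves the discharge of
`Literature.Analysis.FluidPDE.IsClassicalNSSolutionOn.isLerayHopfOn`, Leray 1934 §32).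

Let `E` be a finite-dimensional real inner product space with its Lebesgue measure `volume`.
This file provides the boundary-free integration-by-parts identities used to pass from
classical to weak formulations of the Navier–Stokes equations, all derived from Mathlib's
`integral_bilinear_hasFDerivAt_right_eq_neg_left_of_integrable`:

* `integral_fderiv_apply_eq_zero`: `∫ ∂ᵥ h = 0` for `h ∈ C¹_c(E; F)`;
* `integral_divergence_eq_zero`: `∫ div w = 0` for `w ∈ C¹_c(E; E)`;
* `integral_mul_divergence_add_eq_zero`: `∫ θ div u + ∫ ⟪u, ∇θ⟫ = 0` (one factor compactly
  supported) and the pressure identity `∫ ⟪∇p, ψ⟫ = -∫ p div ψ`;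
* `integral_inner_convect_add_eq_zero`: the trilinear identity
  `∫ ⟪(u·∇)v, w⟫ + ∫ ⟪v, (u·∇)w⟫ + ∫ (div u) ⟪v, w⟫ = 0`;
* `integral_inner_laplacian_add_eq_zero`: `∫ ⟪Δv, w⟫ + Σᵢ ∫ ⟪∂ᵢv, ∂ᵢw⟫ = 0`;
* the discharge `HasWeakGradient.of_contDiff_holds` of the named fact
  `Literature.Analysis.FluidPDE.HasWeakGradient.of_contDiff` (a `C¹` field has its classical derivative as weak
  gradient), a one-line specialisation of `Literature.Analysis.FunctionSpaces.HasWeakFDerivOn.of_contDiff_holds`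
  (`FunctionSpaces/SobolevDomainProofs`) to `Ω = ⊤`, `μ = volume`, and its term form
  `hasWeakGradient_fderiv_of_contDiff`;
* `Fluid.cutoff R`: the smooth cut-off `x ↦ χ(x / R)` with `χ = Literature.dyadicCutoff E`, the tree's
  canonical bump (`= 1` on the unit ball, supported in the ball of radius `2`; accepted
  `Literature/Analysis/FunctionSpaces/LittlewoodPaley`, reused rather than redefined), with
  `‖D(cutoff R)(x)‖ ≤ C / R`.

## Mathlib search

Mathlib (this pin) has integration by parts on finite-dimensional spaces for *integrable*
functions with integrable derivatives (`Mathlib/Analysis/Calculus/LineDeriv/IntegrationByParts`),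
bump functions `ContDiffBump` (no derivative bounds), the Laplacian
`laplacian_eq_iteratedFDeriv_orthonormalBasis`; it has no divergence theorem on the whole space
in the `div` form and no cut-off family with `1/R` gradient bounds (searched `divergence`,
`cutoff`, `norm_fderiv_le` in `BumpFunction/`: none). The tree has the fixed bump
`Literature.Analysis.FunctionSpaces.dyadicCutoff` (reused here), the torus divergence theorem
`TorusCalculus.integral_divergence_eq_zero` (different setting), and the general weak-derivative
discharge `Literature.Analysis.FunctionSpaces.HasWeakFDerivOn.of_contDiff_holds` (reused here for `HasWeakGradient.of_contDiff`).

## References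

* L. C. Evans, *Partial Differential Equations*, 2nd ed. (2010), App. C.2 (Gauss–Green), §5.2.1.
* J. Leray, *Sur le mouvement d'un liquide visqueux emplissant l'espace*, Acta Math. 63 (1934),
  §6 (1.11) p. 203 (integration by parts on the whole space, no boundary terms), §7 (1.16)
  p. 205 (quasi-derivatives), §17 (3.4) p. 220 (energy dissipation relation).
-/

noncomputable section

open MeasureTheory TopologicalSpace Set Function Filter Topology InnerProductSpace
open scoped RealInnerProductSpace ENNReal NNReal Laplacian

namespace Literature.Analysis.FluidPDE

/-! ### Pointwise Leibniz rules -/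

section Pointwise

variable {E : Type*} [NormedAddCommGroup E] [InnerProductSpace ℝ E] [FiniteDimensional ℝ E]
variable {F' : Type*} [NormedAddCommGroup F'] [InnerProductSpace ℝ F']

/-- Leibniz rule for the divergence of `θ • u`: `div (θ u) = θ div u + ⟪u, ∇θ⟫` at points of
differentiability. [folklore] -/
theorem divergence_smul_apply {θ : E → ℝ} {u : E → E} {x : E} (hθ : DifferentiableAt ℝ θ x)
    (hu : DifferentiableAt ℝ u x) :
    VectorCalculus.divergence (fun y => θ y • u y) x = θ x * VectorCalculus.divergence u x + ⟪u x, gradient θ x⟫ := by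
  let b := stdOrthonormalBasis ℝ E
  rw [divergence_eq_sum_inner_fderiv b, divergence_eq_sum_inner_fderiv b, fderiv_fun_smul hθ hu,
    Finset.mul_sum]
  simp only [_root_.add_apply, _root_.FunLike.coe_smul, Pi.smul_apply,
    ContinuousLinearMap.smulRight_apply, inner_add_right, Finset.sum_add_distrib,
    real_inner_smul_right]
  congr 1
  rw [real_inner_comm, gradient, InnerProductSpace.toDual_symm_apply]
  calc ∑ i, fderiv ℝ θ x (b i) * ⟪b i, u x⟫
      = fderiv ℝ θ x (∑ i, ⟪b i, u x⟫ • b i) := by simp [mul_comm]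
    _ = fderiv ℝ θ x (u x) := by rw [b.sum_repr']

omit [FiniteDimensional ℝ E] in
/-- The convective derivative of `θ • w`: `(u·∇)(θ w) = θ (u·∇)w + (∂ᵤθ) w`
(Leibniz rule). [folklore] -/
theorem convect_smul_apply {θ : E → ℝ} {u : E → E} {w : E → F'} {x : E}
    (hθ : DifferentiableAt ℝ θ x) (hw : DifferentiableAt ℝ w x) :
    convect u (fun y => θ y • w y) x = θ x • convect u w x + (fderiv ℝ θ x (u x)) • w x := by
  simp [convect, fderiv_fun_smul hθ hw]

omit [FiniteDimensional ℝ E] in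
/-- The second directional derivative `∂ᵢ∂ᵢ v` along `e` equals the second Fréchet derivative
evaluated at `(e, e)` for `C²` fields (Mathlib `fderiv_clm_apply`). [folklore] -/
theorem fderiv_fderiv_apply_const {v : E → F'} (hv : ContDiff ℝ 2 v) (x e : E) :
    fderiv ℝ (fun y => fderiv ℝ v y e) x e = iteratedFDeriv ℝ 2 v x ![e, e] := by
  have hd : DifferentiableAt ℝ (fderiv ℝ v) x :=
    ((hv.fderiv_right (m := 1) le_rfl).differentiable one_ne_zero) x
  rw [iteratedFDeriv_two_apply, fderiv_clm_apply hd (differentiableAt_const e)]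
  simp

/-- The Laplacian as the sum of pure second partial derivatives over an orthonormal basis:
`Δ v (x) = Σᵢ ∂ᵢ∂ᵢ v (x)` for `C²` fields (Mathlib
`laplacian_eq_iteratedFDeriv_orthonormalBasis`). [folklore] -/
theorem laplacian_eq_sum_fderiv_fderiv {ι : Type*} [Fintype ι] (b : OrthonormalBasis ι ℝ E)
    {v : E → F'} (hv : ContDiff ℝ 2 v) (x : E) :
    (Δ v) x = ∑ i, fderiv ℝ (fun y => fderiv ℝ v y (b i)) x (b i) := by
  rw [laplacian_eq_iteratedFDeriv_orthonormalBasis v b]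
  exact Finset.sum_congr rfl fun i _ => (fderiv_fderiv_apply_const hv x (b i)).symm

/-- The Laplacian of a `C²` field is continuous. [folklore] -/
theorem continuous_laplacian {v : E → F'} (hv : ContDiff ℝ 2 v) : Continuous (Δ v) := by
  have : Δ v = fun x => ∑ i, fderiv ℝ (fun y => fderiv ℝ v y (stdOrthonormalBasis ℝ E i)) x
      (stdOrthonormalBasis ℝ E i) := funext (laplacian_eq_sum_fderiv_fderiv _ hv)
  rw [this]
  exact continuous_finsetSum _ fun i _ =>
    (((hv.fderiv_right (m := 1) le_rfl).clm_apply contDiff_const).continuous_fderiv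
      one_ne_zero).clm_apply continuous_const

/-- The Laplacian of `v` vanishes off the topological support of `v`. [folklore] -/
theorem laplacian_eq_zero_of_notMem_tsupport {v : E → F'} {x : E} (hx : x ∉ tsupport v) :
    (Δ v) x = 0 := by
  rw [laplacian_eq_iteratedFDeriv_orthonormalBasis v (stdOrthonormalBasis ℝ E)]
  refine Finset.sum_eq_zero fun i _ => ?_
  have : iteratedFDeriv ℝ 2 v x = 0 := by
    by_contra h
    exact hx (support_iteratedFDeriv_subset 2 (mem_support.2 h))
  rw [this]
  rfl

/-- The Frobenius norm of the derivative dominates each partial derivative: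
`‖Dv(x) bᵢ‖² ≤ |Dv(x)|²` for an orthonormal basis `b` (Majda–Bertozzi, §1.2). [folklore] -/
theorem norm_apply_sq_le_frobeniusNormSq [FiniteDimensional ℝ F'] {ι : Type*} [Fintype ι]
    (b : OrthonormalBasis ι ℝ E) (L : E →L[ℝ] F') (i : ι) :
    ‖L (b i)‖ ^ 2 ≤ frobeniusNormSq L := by
  rw [frobeniusNormSq_eq_sum b]
  exact Finset.single_le_sum (f := fun j => ‖L (b j)‖ ^ 2) (fun j _ => sq_nonneg _)
    (Finset.mem_univ i)

end Pointwise

/-! ### Integration by parts without boundary terms -/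

section IBP

variable {E : Type*} [NormedAddCommGroup E] [InnerProductSpace ℝ E] [FiniteDimensional ℝ E]
  [MeasurableSpace E] [BorelSpace E]
variable {F : Type*} [NormedAddCommGroup F] [NormedSpace ℝ F]
variable {F' : Type*} [NormedAddCommGroup F'] [InnerProductSpace ℝ F']

omit [MeasurableSpace E] [BorelSpace E] in
/-- The divergence of a field with continuous derivative is continuous (finite sum of
continuous partial derivatives). [folklore] -/
theorem continuous_divergence {u : E → E} (hu : Continuous (fderiv ℝ u)) :
    Continuous (VectorCalculus.divergence u) := by
  have : VectorCalculus.divergence u = fun x => ∑ i, ⟪stdOrthonormalBasis ℝ E i,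
      fderiv ℝ u x (stdOrthonormalBasis ℝ E i)⟫ :=
    funext (divergence_eq_sum_inner_fderiv (stdOrthonormalBasis ℝ E) u)
  rw [this]
  exact continuous_finsetSum _ fun i _ => continuous_const.inner (hu.clm_apply continuous_const)

omit [FiniteDimensional ℝ E] [MeasurableSpace E] [BorelSpace E] in
/-- The divergence vanishes off the topological support. [folklore] -/
theorem divergence_eq_zero_of_notMem_tsupport {u : E → E} {x : E} (hx : x ∉ tsupport u) :
    VectorCalculus.divergence u x = 0 := by
  rw [VectorCalculus.divergence, fderiv_of_notMem_tsupport ℝ hx]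
  simp

omit [MeasurableSpace E] [BorelSpace E] in
/-- The gradient of a `C¹` function is continuous. [folklore] -/
theorem continuous_gradient_of_contDiff {θ : E → ℝ} (hθ : ContDiff ℝ 1 θ) :
    Continuous (gradient θ) :=
  (InnerProductSpace.toDual ℝ E).symm.continuous.comp (hθ.continuous_fderiv one_ne_zero)

omit [MeasurableSpace E] [BorelSpace E] in
/-- The gradient vanishes off the topological support. [folklore] -/
theorem gradient_eq_zero_of_notMem_tsupport {θ : E → ℝ} {x : E} (hx : x ∉ tsupport θ) :
    gradient θ x = 0 := by
  simp [gradient, fderiv_of_notMem_tsupport ℝ hx]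

/-- **No boundary terms on the whole space.** For `h ∈ C¹_c(E; F)` and every direction `v`,
`∫ ∂ᵥ h = 0` (Leray 1934, §6, (1.11) p. 203: `∫ (u ∂ᵢa + ∂ᵢu a) dy = 0`, here with `a = 1`
near the support; Evans, *PDE*, App. C.2, Gauss–Green with empty boundary; from Mathlib's
integration by parts against the constant function `1`). [cite: Leray1934, §6 (1.11) p. 203] -/
theorem integral_fderiv_apply_eq_zero {h : E → F} (hh : ContDiff ℝ 1 h)
    (hc : HasCompactSupport h) (v : E) : ∫ x, fderiv ℝ h x v = 0 := by
  have key := integral_bilinear_hasFDerivAt_right_eq_neg_left_of_integrable (μ := volume)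
    (f := fun _ : E => (1 : ℝ)) (f' := fun _ => (0 : E →L[ℝ] ℝ)) (g := h) (g' := fderiv ℝ h)
    (v := v) (B := ContinuousLinearMap.lsmul ℝ ℝ) ?_ ?_ ?_ ?_ ?_
  · simpa using key
  · simp
  · simp only [ContinuousLinearMap.lsmul_apply, one_smul]
    exact ((hh.continuous_fderiv one_ne_zero).clm_apply continuous_const)
      |>.integrable_of_hasCompactSupport (hc.fderiv_apply (𝕜 := ℝ) v)
  · simpa using hh.continuous.integrable_of_hasCompactSupport hc
  · intro x _
    exact hasFDerivAt_const _ _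
  · intro x _
    exact (hh.differentiable one_ne_zero x).hasFDerivAt

/-- **Divergence theorem without boundary.** For `w ∈ C¹_c(E; E)`, `∫ div w = 0`
(sum of (1.11) of Leray 1934, §6, over the components; Evans, *PDE*, App. C.2). [cite: Leray1934, §6 (1.11) p. 203] -/
theorem integral_divergence_eq_zero {w : E → E} (hw : ContDiff ℝ 1 w)
    (hc : HasCompactSupport w) : ∫ x, VectorCalculus.divergence w x = 0 := by
  haveI : CompleteSpace E := FiniteDimensional.complete ℝ E
  let b := stdOrthonormalBasis ℝ E
  simp_rw [divergence_eq_sum_inner_fderiv b]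
  have hint : ∀ i, Integrable (fun x => fderiv ℝ w x (b i)) (volume : Measure E) := fun i =>
    ((hw.continuous_fderiv one_ne_zero).clm_apply continuous_const).integrable_of_hasCompactSupport
      (hc.fderiv_apply (𝕜 := ℝ) (b i))
  rw [integral_finsetSum _ fun i _ => (hint i).const_inner (b i)]
  refine Finset.sum_eq_zero fun i _ => ?_
  rw [integral_inner (hint i), integral_fderiv_apply_eq_zero hw hc, inner_zero_right]

/-- **`∫ θ div u + ∫ ⟪u, ∇θ⟫ = 0`** for `C¹` fields when `θ • u` has compact support and both
integrands are integrable (core version; Leray 1934, §6 (1.11) applied to `div (θ u)`;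
Evans, *PDE*, App. C.2, Thm. 2). [cite: Leray1934, §6 (1.11) p. 203] -/
theorem integral_mul_divergence_add_eq_zero {θ : E → ℝ} {u : E → E} (hθ : ContDiff ℝ 1 θ)
    (hu : ContDiff ℝ 1 u) (hc : HasCompactSupport fun x => θ x • u x)
    (h₁ : Integrable (fun x => θ x * VectorCalculus.divergence u x))
    (h₂ : Integrable (fun x => ⟪u x, gradient θ x⟫)) :
    (∫ x, θ x * VectorCalculus.divergence u x) + ∫ x, ⟪u x, gradient θ x⟫ = 0 := by
  rw [← integral_add h₁ h₂]
  have := integral_divergence_eq_zero (w := fun x => θ x • u x) (hθ.smul hu) hc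
  rw [← this]
  refine integral_congr_ae (Eventually.of_forall fun x => ?_)
  exact (divergence_smul_apply (hθ.differentiable one_ne_zero x)
    (hu.differentiable one_ne_zero x)).symm

/-- `∫ θ div u + ∫ ⟪u, ∇θ⟫ = 0` when the scalar factor `θ ∈ C¹_c` (Leray 1934, §6 (1.11)). [cite: Leray1934, §6 (1.11) p. 203] -/
theorem integral_mul_divergence_add_eq_zero_left {θ : E → ℝ} {u : E → E} (hθ : ContDiff ℝ 1 θ)
    (hu : ContDiff ℝ 1 u) (hc : HasCompactSupport θ) :
    (∫ x, θ x * VectorCalculus.divergence u x) + ∫ x, ⟪u x, gradient θ x⟫ = 0 := by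
  refine integral_mul_divergence_add_eq_zero hθ hu (hc.smul_right (f' := u)) ?_ ?_
  · exact (hθ.continuous.mul (continuous_divergence (hu.continuous_fderiv one_ne_zero)))
      |>.integrable_of_hasCompactSupport hc.mul_right
  · refine (hu.continuous.inner (continuous_gradient_of_contDiff hθ))
      |>.integrable_of_hasCompactSupport (hc.mono' fun x hx => ?_)
    contrapose! hx
    simp only [mem_support, not_not]
    rw [gradient_eq_zero_of_notMem_tsupport hx, inner_zero_right]

/-- `∫ θ div u + ∫ ⟪u, ∇θ⟫ = 0` when the vector factor `u ∈ C¹_c` (Leray 1934, §6 (1.11)). [cite: Leray1934, §6 (1.11) p. 203] -/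
theorem integral_mul_divergence_add_eq_zero_right {θ : E → ℝ} {u : E → E}
    (hθ : ContDiff ℝ 1 θ) (hu : ContDiff ℝ 1 u) (hc : HasCompactSupport u) :
    (∫ x, θ x * VectorCalculus.divergence u x) + ∫ x, ⟪u x, gradient θ x⟫ = 0 := by
  refine integral_mul_divergence_add_eq_zero hθ hu (hc.smul_left (f := θ)) ?_ ?_
  · refine (hθ.continuous.mul (continuous_divergence (hu.continuous_fderiv one_ne_zero)))
      |>.integrable_of_hasCompactSupport ?_
    refine hc.mono' fun x hx => ?_
    contrapose! hx
    simp [divergence_eq_zero_of_notMem_tsupport hx]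
  · exact (hu.continuous.inner (continuous_gradient_of_contDiff hθ)).integrable_of_hasCompactSupport
      (hc.mono fun x hx => by contrapose! hx; simp_all)

/-- **The pressure drops out against divergence-free tests**: for `p ∈ C¹` and `ψ ∈ C¹_c(E; E)`,
`∫ ⟪∇p, ψ⟫ = -∫ p div ψ` (Leray 1934, §6 (1.11); this is how the pressure disappears from
Leray's weak relation (17)). [cite: Leray1934, §6 (1.11) p. 203] -/
theorem integral_inner_gradient_eq_neg_integral_mul_divergence {p : E → ℝ} {ψ : E → E}
    (hp : ContDiff ℝ 1 p) (hψ : ContDiff ℝ 1 ψ) (hc : HasCompactSupport ψ) :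
    ∫ x, ⟪gradient p x, ψ x⟫ = -∫ x, p x * VectorCalculus.divergence ψ x := by
  have h := integral_mul_divergence_add_eq_zero_right hp hψ hc
  have h' : ∫ x, ⟪gradient p x, ψ x⟫ = ∫ x, ⟪ψ x, gradient p x⟫ :=
    integral_congr_ae (Eventually.of_forall fun x => real_inner_comm _ _)
  linarith

/-- **Trilinear convection identity.** For `u ∈ C¹(E; E)`, `v, w ∈ C¹(E; F')` with `w`
compactly supported,
`∫ ⟪(u·∇)v, w⟫ + ∫ ⟪v, (u·∇)w⟫ + ∫ (div u) ⟪v, w⟫ = 0`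
(apply `∫ θ div u + ∫ ⟪u, ∇θ⟫ = 0` to `θ = ⟪v, w⟫`; Leray 1934, §6 (1.11) and §17, where
`∫ uₖ ∂ₖuᵢ uᵢ = 0` yields (3.4); Majda–Bertozzi, §1.2, proof of Prop. 1.11). [cite: Leray1934, §6 (1.11) p. 203] -/
theorem integral_inner_convect_add_eq_zero {u : E → E} {v w : E → F'} (hu : ContDiff ℝ 1 u)
    (hv : ContDiff ℝ 1 v) (hw : ContDiff ℝ 1 w) (hc : HasCompactSupport w) :
    (∫ x, ⟪convect u v x, w x⟫) + (∫ x, ⟪v x, convect u w x⟫) +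
      ∫ x, VectorCalculus.divergence u x * ⟪v x, w x⟫ = 0 := by
  have hθ : ContDiff ℝ 1 fun x => ⟪v x, w x⟫ := hv.inner ℝ hw
  have hcθ : HasCompactSupport fun x => ⟪v x, w x⟫ :=
    hc.mono fun x hx => by contrapose! hx; simp_all
  have h := integral_mul_divergence_add_eq_zero_left hθ hu hcθ
  have hgrad : ∀ x, ⟪u x, gradient (fun y => ⟪v y, w y⟫) x⟫ =
      ⟪convect u v x, w x⟫ + ⟪v x, convect u w x⟫ := fun x => by
    rw [gradient, real_inner_comm, InnerProductSpace.toDual_symm_apply,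
      fderiv_inner_apply ℝ (hv.differentiable one_ne_zero x) (hw.differentiable one_ne_zero x)]
    simp [convect, add_comm]
  simp_rw [hgrad] at h
  have hi₁ : Integrable (fun x => ⟪convect u v x, w x⟫) (volume : Measure E) :=
    ((((hv.continuous_fderiv one_ne_zero).clm_apply hu.continuous)).inner hw.continuous)
      |>.integrable_of_hasCompactSupport (hc.mono fun x hx => by contrapose! hx; simp_all)
  have hi₂ : Integrable (fun x => ⟪v x, convect u w x⟫) (volume : Measure E) := by
    refine (hv.continuous.inner ((hw.continuous_fderiv one_ne_zero).clm_apply hu.continuous))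
      |>.integrable_of_hasCompactSupport ((hc.fderiv (𝕜 := ℝ)).mono fun x hx => ?_)
    contrapose! hx
    simp only [mem_support, not_not] at hx
    simp [convect, hx]
  rw [integral_add hi₁ hi₂] at h
  simp_rw [mul_comm (VectorCalculus.divergence u _)] at h ⊢
  linarith

/-- **Green's first identity without boundary.** For `v ∈ C²(E; F')`, `w ∈ C¹(E; F')`, one of
them compactly supported, and any orthonormal basis `b`,
`∫ ⟪Δv, w⟫ + Σᵢ ∫ ⟪∂ᵢv, ∂ᵢw⟫ = 0` (Leray 1934, §6 (1.11) applied to `u = ∂ᵢv`, `a = w`;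
Evans, *PDE*, App. C.2, Thm. 3 (Green's formulas) with empty boundary). [cite: Leray1934, §6 (1.11) p. 203] -/
theorem integral_inner_laplacian_add_eq_zero {ι : Type*} [Fintype ι] (b : OrthonormalBasis ι ℝ E)
    {v w : E → F'} (hv : ContDiff ℝ 2 v) (hw : ContDiff ℝ 1 w)
    (hc : HasCompactSupport v ∨ HasCompactSupport w) :
    (∫ x, ⟪(Δ v) x, w x⟫) + ∑ i, ∫ x, ⟪fderiv ℝ v x (b i), fderiv ℝ w x (b i)⟫ = 0 := by
  -- the partial derivatives `∂ᵢ v` are `C¹`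
  have hv1 : ContDiff ℝ 1 v := hv.of_le one_le_two
  have hdv : ∀ i, ContDiff ℝ 1 fun y => fderiv ℝ v y (b i) := fun i =>
    (hv.fderiv_right (m := 1) le_rfl).clm_apply contDiff_const
  -- a compact set off which everything vanishes
  obtain ⟨K, hK, hKv⟩ : ∃ K : Set E, IsCompact K ∧ ∀ x ∉ K,
      (fderiv ℝ v x = 0 ∧ (Δ v) x = 0 ∧ ∀ i, fderiv ℝ (fun y => fderiv ℝ v y (b i)) x = 0) ∨
      (w x = 0 ∧ fderiv ℝ w x = 0) := by
    rcases hc with hc | hc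
    · refine ⟨tsupport v, hc, fun x hx => Or.inl ⟨fderiv_of_notMem_tsupport ℝ hx,
        laplacian_eq_zero_of_notMem_tsupport hx, fun i => fderiv_of_notMem_tsupport ℝ ?_⟩⟩
      exact fun h => hx (tsupport_fderiv_apply_subset ℝ (b i) h)
    · exact ⟨tsupport w, hc, fun x hx => Or.inr ⟨image_eq_zero_of_notMem_tsupport hx,
        fderiv_of_notMem_tsupport ℝ hx⟩⟩
  -- the scalar functions `Hᵢ = ⟪∂ᵢ v, w⟫`
  set H : ι → E → ℝ := fun i x => ⟪fderiv ℝ v x (b i), w x⟫ with hH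
  have hHc : ∀ i, ContDiff ℝ 1 (H i) := fun i => (hdv i).inner ℝ hw
  have hHs : ∀ i, HasCompactSupport (H i) := fun i =>
    HasCompactSupport.intro hK fun x hx => by
      rcases hKv x hx with ⟨h1, -, -⟩ | ⟨h1, -⟩ <;> simp [hH, h1]
  have hHd : ∀ i x, fderiv ℝ (H i) x (b i) =
      ⟪fderiv ℝ v x (b i), fderiv ℝ w x (b i)⟫ +
        ⟪fderiv ℝ (fun y => fderiv ℝ v y (b i)) x (b i), w x⟫ := fun i x => by
    rw [hH, fderiv_inner_apply ℝ ((hdv i).differentiable one_ne_zero x)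
      (hw.differentiable one_ne_zero x)]
  -- integrability of the two families
  have hi₁ : ∀ i, Integrable (fun x => ⟪fderiv ℝ v x (b i), fderiv ℝ w x (b i)⟫)
      (volume : Measure E) := fun i => by
    refine Continuous.integrable_of_hasCompactSupport ?_ (HasCompactSupport.intro hK ?_)
    · exact ((hv1.continuous_fderiv one_ne_zero).clm_apply continuous_const).inner
        ((hw.continuous_fderiv one_ne_zero).clm_apply continuous_const)
    · intro x hx
      rcases hKv x hx with ⟨h1, -, -⟩ | ⟨-, h2⟩
      · simp [h1]
      · simp [h2]
  have hi₂ : ∀ i, Integrable (fun x => ⟪fderiv ℝ (fun y => fderiv ℝ v y (b i)) x (b i), w x⟫)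
      (volume : Measure E) := fun i => by
    refine Continuous.integrable_of_hasCompactSupport ?_ (HasCompactSupport.intro hK ?_)
    · exact (((hdv i).continuous_fderiv one_ne_zero).clm_apply continuous_const).inner
        hw.continuous
    · intro x hx
      rcases hKv x hx with ⟨-, -, h3⟩ | ⟨h2, -⟩
      · simp [h3]
      · simp [h2]
  -- sum the identities `∫ ∂ᵢ Hᵢ = 0`
  have hsum : ∑ i, ((∫ x, ⟪fderiv ℝ v x (b i), fderiv ℝ w x (b i)⟫) +
      ∫ x, ⟪fderiv ℝ (fun y => fderiv ℝ v y (b i)) x (b i), w x⟫) = 0 := by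
    refine Finset.sum_eq_zero fun i _ => ?_
    rw [← integral_add (hi₁ i) (hi₂ i), ← integral_fderiv_apply_eq_zero (hHc i) (hHs i) (b i)]
    exact integral_congr_ae (Eventually.of_forall fun x => (hHd i x).symm)
  rw [Finset.sum_add_distrib, ← integral_finsetSum _ fun i _ => hi₂ i] at hsum
  have hlap : ∀ x, ∑ i, ⟪fderiv ℝ (fun y => fderiv ℝ v y (b i)) x (b i), w x⟫ =
      ⟪(Δ v) x, w x⟫ := fun x => by
    rw [← sum_inner, laplacian_eq_sum_fderiv_fderiv b hv x]
  simp_rw [hlap] at hsum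
  linarith

/-- **Discharge** of the named fact `Literature.Analysis.FluidPDE.HasWeakGradient.of_contDiff`: a `C¹` field has its
classical derivative as weak gradient. This is the specialisation `Ω = ⊤`, `μ = volume` of the
general discharge `Literature.Analysis.FunctionSpaces.HasWeakFDerivOn.of_contDiff_holds`
(`Literature/Analysis/FunctionSpaces/SobolevDomainProofs`), exactly the interim proof preserved
in the docstring of the fact (Leray 1934, §7, (1.16) p. 205: the defining relation of Leray's
*quasi-dérivées*, satisfied by genuine derivatives; Evans, *PDE*, §5.2.1). [cite: Leray1934, §7 (1.16) p. 205] -/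
theorem HasWeakGradient.of_contDiff_holds : HasWeakGradient.of_contDiff (E := E) (F' := F') :=
  fun hu => FunctionSpaces.HasWeakFDerivOn.of_contDiff_holds ⊤ volume hu

/-- `C¹` fields have their classical derivative as weak gradient (term form of
`HasWeakGradient.of_contDiff_holds`). [cite: Leray1934, §7 (1.16) p. 205] -/
theorem hasWeakGradient_fderiv_of_contDiff {u : E → F'} (hu : ContDiff ℝ 1 u) :
    HasWeakGradient u (fderiv ℝ u) :=
  HasWeakGradient.of_contDiff_holds hu

end IBP

/-! ### Smooth cut-offs -/

section Cutoff

variable {E : Type*} [NormedAddCommGroup E] [InnerProductSpace ℝ E]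

/-- The smooth cut-off at scale `R`: `cutoff R x = χ(x / R)` with `χ = Literature.dyadicCutoff E` (the
tree's canonical bump: `= 1` on the closed unit ball, supported in the ball of radius `2`, values
in `[0, 1]`); hence `cutoff R = 1` on `‖x‖ ≤ R`, `= 0` on `‖x‖ ≥ 2R`, gradient `O(1/R)` (the
standard truncation; cf. the spheres of radius `r₀ → ∞` in Leray 1934, §6). **Junk value:**
`cutoff 0 = 1` identically (`0⁻¹ = 0`); every `R`-sensitive lemma below assumes `0 < R`. [folklore] -/
def cutoff (R : ℝ) (x : E) : ℝ := FunctionSpaces.dyadicCutoff E (R⁻¹ • x)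

variable {R : ℝ} {x : E}

/-- Unfolding the cut-off. [folklore] -/
theorem cutoff_apply (R : ℝ) (x : E) : cutoff R x = FunctionSpaces.dyadicCutoff E (R⁻¹ • x) := rfl

/-- The junk value at `R = 0`: `cutoff 0 x = 1`. [folklore] -/
theorem cutoff_zero (x : E) : cutoff 0 x = 1 := by
  simp [cutoff, FunctionSpaces.dyadicCutoff_apply_of_norm_le_one]

/-- The cut-off is nonnegative. [folklore] -/
theorem cutoff_nonneg (R : ℝ) (x : E) : 0 ≤ cutoff R x := (FunctionSpaces.dyadicCutoff E).nonneg

/-- The cut-off is at most `1`. [folklore] -/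
theorem cutoff_le_one (R : ℝ) (x : E) : cutoff R x ≤ 1 := (FunctionSpaces.dyadicCutoff E).le_one

/-- `|cutoff R x| ≤ 1`. [folklore] -/
theorem abs_cutoff_le_one (R : ℝ) (x : E) : |cutoff R x| ≤ 1 :=
  abs_le.2 ⟨by linarith [cutoff_nonneg R x], cutoff_le_one R x⟩

/-- The cut-off equals `1` on the ball of radius `R`. [folklore] -/
theorem cutoff_eq_one (hR : 0 < R) (hx : ‖x‖ ≤ R) : cutoff R x = 1 := by
  apply FunctionSpaces.dyadicCutoff_apply_of_norm_le_one
  rw [norm_smul, norm_inv, Real.norm_of_nonneg hR.le]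
  calc R⁻¹ * ‖x‖ ≤ R⁻¹ * R := by gcongr
    _ = 1 := inv_mul_cancel₀ hR.ne'

/-- The cut-off vanishes off the ball of radius `2R`. [folklore] -/
theorem cutoff_eq_zero (hR : 0 < R) (hx : 2 * R ≤ ‖x‖) : cutoff R x = 0 := by
  apply FunctionSpaces.dyadicCutoff_apply_of_two_le_norm
  rw [norm_smul, norm_inv, Real.norm_of_nonneg hR.le]
  calc (2 : ℝ) = R⁻¹ * (2 * R) := by field_simp
    _ ≤ R⁻¹ * ‖x‖ := by gcongr

/-- Eventually in `R → ∞` the cut-off equals `1` at any fixed point. [folklore] -/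
theorem eventually_cutoff_eq_one (x : E) : ∀ᶠ R in atTop, cutoff R x = 1 := by
  filter_upwards [eventually_ge_atTop ‖x‖, eventually_gt_atTop 0] with R hR hR0
  exact cutoff_eq_one hR0 hR

/-- Along the natural numbers, `cutoff (n + 1) x → 1`. [folklore] -/
theorem tendsto_cutoff_natCast_add_one (x : E) :
    Tendsto (fun n : ℕ => cutoff ((n : ℝ) + 1) x) atTop (𝓝 1) :=
  tendsto_const_nhds.congr' <| by
    have := (eventually_cutoff_eq_one x).filter_mono
      (tendsto_natCast_atTop_atTop.atTop_add tendsto_const_nhds :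
        Tendsto (fun n : ℕ => (n : ℝ) + 1) atTop atTop)
    filter_upwards [this] with n hn using hn.symm

/-- The cut-off is smooth. [folklore] -/
theorem contDiff_cutoff {n : ℕ∞} (R : ℝ) : ContDiff ℝ n (cutoff (E := E) R) :=
  (FunctionSpaces.dyadicCutoff E).contDiff.comp (contDiff_const_smul R⁻¹)

variable [FiniteDimensional ℝ E]

/-- The cut-off has compact support (for `R > 0`). [folklore] -/
theorem hasCompactSupport_cutoff (hR : 0 < R) : HasCompactSupport (cutoff (E := E) R) := by
  refine HasCompactSupport.intro (isCompact_closedBall (0 : E) (2 * R)) fun x hx => ?_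
  rw [mem_closedBall_zero_iff, not_le] at hx
  exact cutoff_eq_zero hR hx.le

/-- **Gradient bound.** There is `C ≥ 0` with `‖D(cutoff R)(x)‖ ≤ C / R` for all `R > 0` and
all `x` (chain rule `D(χ(·/R)) = R⁻¹ Dχ(·/R)` and boundedness of `Dχ`). [folklore] -/
theorem exists_norm_fderiv_cutoff_le :
    ∃ C : ℝ, 0 ≤ C ∧ ∀ R : ℝ, 0 < R → ∀ x : E, ‖fderiv ℝ (cutoff R) x‖ ≤ C / R := by
  obtain ⟨C, hC⟩ := (((FunctionSpaces.dyadicCutoff E).contDiff (n := 1)).continuous_fderiv one_ne_zero)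
    |>.bounded_above_of_compact_support ((FunctionSpaces.dyadicCutoff E).hasCompactSupport.fderiv (𝕜 := ℝ))
  refine ⟨max C 0, le_max_right _ _, fun R hR x => ?_⟩
  have : fderiv ℝ (cutoff (E := E) R) x = R⁻¹ • fderiv ℝ (FunctionSpaces.dyadicCutoff E) (R⁻¹ • x) :=
    fderiv_comp_smul (𝕜 := ℝ) (f := (FunctionSpaces.dyadicCutoff E : E → ℝ)) (x := x) R⁻¹
  rw [this, norm_smul, norm_inv, Real.norm_of_nonneg hR.le, div_eq_inv_mul]
  gcongr
  exact (hC _).trans (le_max_left _ _)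

end Cutoff

end Literature.Analysis.FluidPDE
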